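import Mathlib.Algebra.QuadraticAlgebra.Basic
import Literature.NumberTheory.QuadraticForms.QuadraticExtensionPlaces
import HarnessLib

/-!
# A quadratic extension inert at a prescribed finite place

Topic `NumberTheory/QuadraticForms`; namespace `Literature.NumberTheory.QuadraticForms`; all
declarations fully proved. For a number field `K` and a finite place `𝔮` of `K` we construct a
quadratic extension `E/K` in which `𝔮` is **inert** (one prime above `𝔮`, unramified, residue
degree `2`), uniformly in `𝔮` (dyadic places included), by the Artin–Schreier-shaped equation

  `E = K(ω)`, `ω² = ω + ρ`, with `ρ ∈ 𝓞 K` such that `X² - X - ρ` has no root modulo `𝔮`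

(`exists_forall_sq_sub_sub_notMem`: the map `x ↦ x² - x` on the finite residue field `𝓞 K / 𝔮` is
not injective, `0, 1 ↦ 0`, hence not surjective). Then:

* `QuadraticAlgebra K ρ 1` (Mathlib) is a field (`X² - X - ρ` has no root in `K`: a root would
  be integral, hence in `𝓞 K`, and reduce to a root modulo `𝔮`), a number field, and a quadratic
  extension of `K`;
* `inertiaDegIn_eq_two` : the inertia degree of `𝔮` in `𝓞 E` is `2` — `ω ∈ 𝓞 E` reduces, modulo
  any prime `𝔓 | 𝔮`, to a root of `X² - X - ρ̄`, which does not lie in `𝓞 K / 𝔮`, so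
  `f(𝔓 | 𝔮) ≠ 1`, and `#{𝔓 | 𝔮} · e · f = 2`;
* `α = 2ω - 1` has `α² = 1 + 4ρ =: θ` and `α ∉ K`, so `E = K(√θ)`, `𝔮` has exactly one place of `E`
  above it, and `θ` is **not a square in `K_𝔮`** (decomposition law
  `QuadraticExtension.ncard_finitePlacesOver_eq_one_iff_not_isSquare`, `QuadraticExtensionPlaces`);
* `exists_inert_quadraticExtension` packages the construction: for every finite place `𝔮` there
  are `θ ∈ K`, non-square in `K_𝔮`, and a quadratic extension `E = K(√θ)` with
  `𝔮.inertiaDegIn (𝓞 (QuadraticAlgebra K (ρ : K) 1)) = 2`.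

This is the global element "`β'` which is a unit of quadratic defect `4𝔬_𝔮` at `𝔮`", making
`F(√β')/F` *unramified of local degree `2` at `𝔮`*, of O'Meara's proof of Hilbert reciprocity
(§71D, proof of Thm. 71:18, step 2; §63A for units of defect `4𝔬`), obtained here without the
dyadic theory of the quadratic defect. Used in `HilbertReciprocityProofs.lean`.

## References

* O. T. O'Meara, *Introduction to quadratic forms*, Grundlehren 117, Springer (1963), §63A
  (63:2–63:4, quadratic defect `4𝔬`), §71D (proof of Thm. 71:18, step 2).
* J. Neukirch, *Algebraic Number Theory*, Springer (1999), Ch. I (8.3) (Dedekind–Kummer) — for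
  comparison; the residue-field argument used here avoids the conductor hypothesis.
-/

noncomputable section

open NumberField IsDedekindDomain

namespace Literature.NumberTheory.QuadraticForms

/-! ### A residue class missed by `x ↦ x² - x` -/

/-- Over a finite field (indeed any finite commutative ring with `0 ≠ 1`) some `c` is not of the
form `x² - x`: the map `x ↦ x² - x` identifies `0` and `1`, so it is not injective, hence not
surjective. [folklore] -/
theorem Finite.exists_forall_sq_sub_ne {F : Type*} [CommRing F] [Nontrivial F] [Finite F] :
    ∃ c : F, ∀ x : F, x ^ 2 - x ≠ c := by
  by_contra h
  push Not at h
  have hsurj : Function.Surjective fun x : F ↦ x ^ 2 - x := fun c ↦ by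
    obtain ⟨x, hx⟩ := h c
    exact ⟨x, hx⟩
  have hinj : Function.Injective fun x : F ↦ x ^ 2 - x := Finite.injective_iff_surjective.mpr hsurj
  have h01 : (fun x : F ↦ x ^ 2 - x) 0 = (fun x : F ↦ x ^ 2 - x) 1 := by simp
  exact zero_ne_one (hinj h01)

variable (K : Type*) [Field K] [NumberField K] (v : HeightOneSpectrum (𝓞 K))

/-- For every finite place `𝔮` of a number field there is `ρ ∈ 𝓞 K` such that `X² - X - ρ` has no
root modulo `𝔮` (lift a residue class missed by `x ↦ x² - x` on the finite field `𝓞 K / 𝔮`).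
[folklore] -/
theorem exists_forall_sq_sub_sub_notMem :
    ∃ ρ : 𝓞 K, ∀ x : 𝓞 K, x ^ 2 - x - ρ ∉ v.asIdeal := by
  haveI : v.asIdeal.IsMaximal := v.isMaximal
  haveI : Finite (𝓞 K ⧸ v.asIdeal) := Ideal.finiteQuotientOfFreeOfNeBot v.asIdeal v.ne_bot
  letI : Field (𝓞 K ⧸ v.asIdeal) := Ideal.Quotient.field v.asIdeal
  obtain ⟨c, hc⟩ := Finite.exists_forall_sq_sub_ne (F := 𝓞 K ⧸ v.asIdeal)
  obtain ⟨ρ, rfl⟩ := Ideal.Quotient.mk_surjective c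
  refine ⟨ρ, fun x hx ↦ hc (Ideal.Quotient.mk v.asIdeal x) ?_⟩
  rw [← map_pow, ← map_sub, Ideal.Quotient.mk_eq_mk_iff_sub_mem]
  exact hx

/-! ### The quadratic extension `K(ω)`, `ω² = ω + ρ` -/

namespace Inert

variable {K} {ρ : 𝓞 K}

omit [NumberField K] in
open Polynomial in
/-- A root `r` of `X² - X - ρ` (`ρ ∈ 𝓞 K`) in a `K`-algebra is integral over `𝓞 K`. [folklore] -/
theorem isIntegral_of_mul_self_eq {L : Type*} [CommRing L] [Algebra K L] {r : L}
    (hr : r * r = r + algebraMap K L ρ) : IsIntegral (𝓞 K) r := by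
  refine ⟨X ^ 2 - X - C ρ, ?_, ?_⟩
  · have : (X ^ 2 - X - C ρ : (𝓞 K)[X]) = X ^ 2 - (X + C ρ) := by ring
    rw [this]
    exact (monic_X_pow 2).sub_of_left (by
      rw [degree_X_pow]
      exact (degree_add_le _ _).trans_lt (by
        rw [max_lt_iff]
        exact ⟨by rw [degree_X]; norm_num, degree_C_le.trans_lt (by norm_num)⟩))
  · simp only [eval₂_sub, eval₂_X_pow, eval₂_X, eval₂_C]
    rw [sq, hr, IsScalarTower.algebraMap_apply (𝓞 K) K L]
    change r + algebraMap K L (ρ : K) - r - algebraMap K L (ρ : K) = 0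
    ring

omit [NumberField K] in
/-- If `X² - X - ρ` has no root modulo `𝔮` then it has no root in `K` (a root is integral over
`𝓞 K`, hence lies in the integrally closed `𝓞 K`, and would reduce to a root modulo `𝔮`).
[folklore] -/
theorem forall_mul_self_ne (hρ : ∀ x : 𝓞 K, x ^ 2 - x - ρ ∉ v.asIdeal) (r : K) :
    r * r ≠ r + (ρ : K) := by
  intro hr
  have hint : IsIntegral (𝓞 K) r := isIntegral_of_mul_self_eq (K := K) (L := K) hr
  haveI : @IsScalarTower ℤ (𝓞 K) K Algebra.toSMul Algebra.toSMul Algebra.toSMul :=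
    IsScalarTower.of_algebraMap_eq' (RingHom.ext_int _ _)
  have hZ : IsIntegral ℤ r := isIntegral_trans (R := ℤ) (A := 𝓞 K) r hint
  set x : 𝓞 K := IsIntegralClosure.mk' (𝓞 K) r hZ with hx_def
  have hx : algebraMap (𝓞 K) K x = r := IsIntegralClosure.algebraMap_mk' _ _ _
  refine hρ x ?_
  have h0 : x ^ 2 - x - ρ = 0 := by
    apply RingOfIntegers.coe_injective
    rw [map_sub, map_sub, map_pow, map_zero, hx, sq, hr]
    change r + algebraMap (𝓞 K) K ρ - r - algebraMap (𝓞 K) K ρ = 0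
    ring
  rw [h0]
  exact zero_mem _

omit [NumberField K] in
/-- Hence the `Fact` under which Mathlib's `QuadraticAlgebra K ρ 1` (`ω² = ρ + ω`) is a field.
[folklore] -/
theorem fact_of_forall_notMem (hρ : ∀ x : 𝓞 K, x ^ 2 - x - ρ ∉ v.asIdeal) :
    Fact (∀ r : K, r ^ 2 ≠ (ρ : K) + 1 * r) :=
  ⟨fun r hr ↦ forall_mul_self_ne v hρ r (by rw [← sq, hr]; ring)⟩

omit [NumberField K] in
/-- `ω² = ω + ρ` in `E = K(ω)` (Mathlib `QuadraticAlgebra.omega_mul_omega_eq_add`). [folklore] -/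
theorem omega_mul_omega :
    (QuadraticAlgebra.omega : QuadraticAlgebra K (ρ : K) 1) * QuadraticAlgebra.omega =
      QuadraticAlgebra.omega + algebraMap K _ (ρ : K) := by
  rw [QuadraticAlgebra.omega_mul_omega_eq_add, one_smul, Algebra.algebraMap_eq_smul_one, add_comm]

omit [NumberField K] in
/-- `ω ∉ K` (its `ω`-coordinate is `1 ≠ 0`). [folklore] -/
theorem algebraMap_ne_omega (r : K) :
    algebraMap K (QuadraticAlgebra K (ρ : K) 1) r ≠ QuadraticAlgebra.omega := by
  intro h
  have him := congrArg QuadraticAlgebra.im h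
  simp [QuadraticAlgebra.omega] at him

section Field

variable [Fact (∀ r : K, r ^ 2 ≠ (ρ : K) + 1 * r)]

/-- `E = K(ω)` is a number field (a finite extension of the number field `K`). [folklore] -/
theorem numberField : NumberField (QuadraticAlgebra K (ρ : K) 1) :=
  NumberField.of_module_finite K _

omit [NumberField K] in
/-- `E = K(ω)` is a quadratic extension of `K` (Mathlib `QuadraticAlgebra.finrank_eq_two`).
[folklore] -/
theorem isQuadraticExtension : Algebra.IsQuadraticExtension K (QuadraticAlgebra K (ρ : K) 1) :=
  ⟨QuadraticAlgebra.finrank_eq_two (ρ : K) 1⟩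

end Field

/-! ### `𝔮` is inert in any quadratic extension generated by a root of `X² - X - ρ` -/

section Inertia

variable {L : Type*} [Field L] [NumberField L] [Algebra K L] [Algebra.IsQuadraticExtension K L]
  {ω : L} (hω : ω * ω = ω + algebraMap K L ρ) (hρ : ∀ x : 𝓞 K, x ^ 2 - x - ρ ∉ v.asIdeal)

omit [NumberField K] [NumberField L] [Algebra.IsQuadraticExtension K L] in
include hω in
/-- `ω` lies in `𝓞 L`. [folklore] -/
theorem exists_ringOfIntegers_eq : ∃ y : 𝓞 L, (y : L) = ω := by
  haveI : @IsScalarTower ℤ (𝓞 K) L Algebra.toSMul Algebra.toSMul Algebra.toSMul :=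
    IsScalarTower.of_algebraMap_eq' (RingHom.ext_int _ _)
  exact ⟨⟨ω, (mem_integralClosure_iff ℤ L).mpr
    (isIntegral_trans (R := ℤ) (A := 𝓞 K) _ (isIntegral_of_mul_self_eq hω))⟩, rfl⟩

include hω hρ in
/-- **The inertia degree of `𝔮` in `L = K(ω)` is not `1`**: modulo a prime `𝔓 | 𝔮` of `𝓞 L`, the
algebraic integer `ω` is a root of `X² - X - ρ̄`; were the residue extension trivial, `ω ≡ c`
for some `c ∈ 𝓞 K` and `c` would be a root of `X² - X - ρ` modulo `𝔓 ∩ 𝓞 K = 𝔮`. [folklore] -/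
theorem inertiaDegIn_ne_one : v.asIdeal.inertiaDegIn (𝓞 L) ≠ 1 := by
  haveI : v.asIdeal.IsMaximal := v.isMaximal
  obtain ⟨⟨P, hP, hPv⟩⟩ := (inferInstance : Nonempty (v.asIdeal.primesOver (𝓞 L)))
  haveI : P.IsMaximal := Ideal.IsMaximal.of_liesOver_isMaximal P v.asIdeal
  rw [Ideal.inertiaDegIn_eq_inertiaDeg v.asIdeal P (L ≃ₐ[K] L),
    Ideal.inertiaDeg_eq_of_isMaximal v.asIdeal P]
  intro h1
  letI : Field (𝓞 K ⧸ v.asIdeal) := Ideal.Quotient.field v.asIdeal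
  obtain ⟨y, hy⟩ := exists_ringOfIntegers_eq (K := K) hω
  -- the residue of `ω` lies in the image of `𝓞 K ⧸ 𝔮`
  have hbot : Ideal.Quotient.mk P y ∈ (⊥ : Subalgebra (𝓞 K ⧸ v.asIdeal) (𝓞 L ⧸ P)) := by
    rw [Subalgebra.bot_eq_top_iff_finrank_eq_one.mpr h1]
    exact Algebra.mem_top
  obtain ⟨c', hc'⟩ := Algebra.mem_bot.mp hbot
  obtain ⟨c, rfl⟩ := Ideal.Quotient.mk_surjective c'
  rw [Ideal.Quotient.algebraMap_mk_of_liesOver] at hc'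
  -- `ω² = ω + ρ` in `𝓞 L`
  have hyy : y ^ 2 - y - algebraMap (𝓞 K) (𝓞 L) ρ = 0 := by
    apply RingOfIntegers.coe_injective
    rw [map_sub, map_sub, map_pow, map_zero]
    change (y : L) ^ 2 - (y : L) - algebraMap K L (ρ : K) = 0
    rw [hy, sq, hω]
    change ω + algebraMap K L (ρ : K) - ω - algebraMap K L (ρ : K) = 0
    ring
  -- hence `c² - c - ρ ≡ 0 (mod 𝔓)`, i.e. `c² - c - ρ ∈ 𝔓 ∩ 𝓞 K = 𝔮`
  have hmem : algebraMap (𝓞 K) (𝓞 L) (c ^ 2 - c - ρ) ∈ P := by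
    rw [← Ideal.Quotient.eq_zero_iff_mem]
    simp only [map_sub, map_pow]
    rw [hc', ← map_pow, ← map_sub, ← map_sub, hyy, map_zero]
  exact hρ c ((Ideal.mem_of_liesOver P v.asIdeal _).mpr hmem)

include hω hρ in
/-- **`𝔮` is inert in `L`**: its inertia degree is `2` (`#{𝔓 | 𝔮} · e · f = [L : K] = 2`,
`QuadraticExtension.ncard_finitePlacesOver_mul_eq_two`, and `f ≠ 1`). [folklore] -/
theorem inertiaDegIn_eq_two : v.asIdeal.inertiaDegIn (𝓞 L) = 2 := by
  have h := QuadraticExtension.ncard_finitePlacesOver_mul_eq_two (K := K) (E := L) v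
  have h1 := inertiaDegIn_ne_one v hω hρ
  have hdvd : v.asIdeal.inertiaDegIn (𝓞 L) ∣ 2 :=
    ⟨(finitePlacesOver L v).ncard * v.asIdeal.ramificationIdxIn (𝓞 L), by rw [← h]; ring⟩
  rcases (Nat.dvd_prime Nat.prime_two).mp hdvd with h' | h'
  · exact absurd h' h1
  · exact h'

include hω hρ in
/-- `𝔮` has exactly one place of `L` above it. [folklore] -/
theorem ncard_finitePlacesOver_eq_one : (finitePlacesOver L v).ncard = 1 := by
  have h := QuadraticExtension.ncard_finitePlacesOver_mul_eq_two (K := K) (E := L) v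
  rw [inertiaDegIn_eq_two v hω hρ] at h
  rcases QuadraticExtension.ncard_finitePlacesOver_eq_one_or_two (K := K) (E := L) v with h1 | h2
  · exact h1
  · rw [h2] at h
    omega

omit [NumberField K] [NumberField L] [Algebra.IsQuadraticExtension K L] in
include hω in
/-- `α = 2ω - 1` squares to `θ = 1 + 4ρ ∈ K`. [folklore] -/
theorem sq_two_mul_sub_one : (2 * ω - 1) ^ 2 = algebraMap K L (1 + 4 * (ρ : K)) := by
  have : (2 * ω - 1) ^ 2 = 4 * (ω * ω) - 4 * ω + 1 := by ring
  rw [this, hω, map_add, map_one, map_mul, map_ofNat]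
  change 4 * (ω + algebraMap K L (ρ : K)) - 4 * ω + 1 = 1 + 4 * algebraMap K L (ρ : K)
  ring

omit [NumberField L] [Algebra.IsQuadraticExtension K L] in
include hω hρ in
/-- `α = 2ω - 1 ∉ K` (otherwise `ω ∈ K` would be a root of `X² - X - ρ`). [folklore] -/
theorem algebraMap_ne_two_mul_sub_one (r : K) : algebraMap K L r ≠ 2 * ω - 1 := by
  intro h
  haveI : CharZero L := charZero_of_injective_algebraMap (algebraMap K L).injective
  have hω' : algebraMap K L ((r + 1) / 2) = ω := by
    rw [map_div₀, map_add, map_one, map_ofNat, h, sub_add_cancel, mul_div_cancel_left₀ ω two_ne_zero]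
  refine forall_mul_self_ne v hρ ((r + 1) / 2) ((algebraMap K L).injective ?_)
  rw [map_mul, map_add, hω', hω]

include hω hρ in
/-- Consequently `θ = 1 + 4ρ = (2ω - 1)²` is **not a square in `K_𝔮`** (decomposition law: two
places above `𝔮` iff `θ ∈ K_𝔮²`,
`QuadraticExtension.ncard_finitePlacesOver_eq_one_iff_not_isSquare`). [folklore] -/
theorem not_isSquare_adicCompletion :
    ¬ IsSquare (algebraMap K (v.adicCompletion K) (1 + 4 * (ρ : K))) :=
  (QuadraticExtension.ncard_finitePlacesOver_eq_one_iff_not_isSquare (K := K) (E := L)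
    (sq_two_mul_sub_one hω) (algebraMap_ne_two_mul_sub_one v hω hρ) v).mp
    (ncard_finitePlacesOver_eq_one v hω hρ)

end Inertia

end Inert

/-! ### Packaging -/

/-- **An inert quadratic extension at a prescribed finite place.** For every finite place `𝔮`
of the number field `K` there are `θ ∈ K`, not a square in `K_𝔮` (in particular `θ ≠ 0`), and
a quadratic extension `E = K(α)`, `α² = θ`, `α ∉ K`, in which `𝔮` has inertia degree `2` — i.e.
`E/K` is unramified of local degree `2` at `𝔮` (O'Meara: `θ` is "a unit of quadratic defect
`4𝔬_𝔮` at `𝔮`", §63A, as used in §71D, proof of 71:18). Here `θ = 1 + 4ρ`, `E = K(ω)`,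
`ω² = ω + ρ` (Mathlib `QuadraticAlgebra K ρ 1`), `α = 2ω - 1`.
[cite: Omeara1963, §71D proof of Thm. 71:18 (step 2), with §63A] -/
theorem exists_inert_quadraticExtension (K : Type) [Field K] [NumberField K]
    (v : HeightOneSpectrum (𝓞 K)) :
    ∃ θ : K, θ ≠ 0 ∧ ¬ IsSquare (algebraMap K (v.adicCompletion K) θ) ∧
      ∃ (E : Type) (_ : Field E) (_ : NumberField E) (_ : Algebra K E)
        (_ : Algebra.IsQuadraticExtension K E) (α : E),
        α ^ 2 = algebraMap K E θ ∧ (∀ r : K, algebraMap K E r ≠ α) ∧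
          v.asIdeal.inertiaDegIn (𝓞 E) = 2 := by
  obtain ⟨ρ, hρ⟩ := exists_forall_sq_sub_sub_notMem K v
  haveI := Inert.fact_of_forall_notMem v hρ
  haveI := Inert.numberField (K := K) (ρ := ρ)
  haveI := Inert.isQuadraticExtension (K := K) (ρ := ρ)
  have hω := Inert.omega_mul_omega (K := K) (ρ := ρ)
  have hnsq := Inert.not_isSquare_adicCompletion v hω hρ
  refine ⟨1 + 4 * (ρ : K), fun h0 ↦ hnsq ?_, hnsq, QuadraticAlgebra K (ρ : K) 1, inferInstance,
    inferInstance, inferInstance, inferInstance, 2 * QuadraticAlgebra.omega - 1,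
    Inert.sq_two_mul_sub_one hω, Inert.algebraMap_ne_two_mul_sub_one v hω hρ,
    Inert.inertiaDegIn_eq_two v hω hρ⟩
  rw [h0, map_zero]
  exact IsSquare.zero

end Literature.NumberTheory.QuadraticForms
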